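import Mathlib

/-!
# Kernel certificate: the 2-adic square test behind the (√2)-criterion for the five ℚ(ζ₈)-instances
(P7-Zeta8Instance v1 §1; P2-MoonenClasses v1 §2 row (15); p2-scripts/zeta8_criterion.py; seat p2, pub-hodge-repro0)

`ℤ₂[√2]/(4√2) ≅ ℤ/8 × ℤ/4` via `a + b√2 ↦ (a mod 8, b mod 4)` (the ideal `(4√2)` is `{8d + 4c√2}`), with
`(x + y√2)² = (x² + 2y²) + 2xy·√2`. If `−β = z²` with `z = x + y√2 ∈ ℤ₂[√2]` (a square in `ℚ₂(√2)` of a 2-adic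
integer is the square of a 2-adic integer: even valuation `≥ 0`), reducing mod `4√2` gives `(x, y) ∈ ℤ/8 × ℤ/4` with
`(x² + 2y² mod 8, 2xy mod 4) = (−a mod 8, −b mod 4)` for `β = a + b√2`. Certified by `decide`:
* `no_square`: NO such `(x, y)` exists for `β ∈ {3+√2, 5+√2, 4+√2, 3, 2+√2}` — hence `−β ∉ ℚ₂(√2)^{×2}`, i.e. `(√2)` is not
  completely split in `K_D/K_D⁺` for any of the five instances (P2-MoonenClasses §2, row (15));
* `unit_squares`: the squares of units (`x` odd) fall into exactly the two classes `(1, 0)` and `(3, 2)` (the latter `= (1+√2)²`);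
* controls: solutions DO exist for `−7` (`≡ 1 mod 8`) and for `−(13 + 2√2)` (`≡ 3 + 2√2`) — the two fields that
  zeta8_split.gp finds completely split — and none for `−(9 + 2√2)` (not split there).
The converse direction (a solution mod `4√2` makes `−β` a genuine square, by Hensel: units `≡ 1 mod 4√2` are squares) is
not needed for the five negative verdicts and is not certified here.
-/

namespace HodgeRepro0.Zeta8Criterion

/-- the square of `x + y√2` reduced mod `4√2`: the pair `(x² + 2y² mod 8, 2xy mod 4)` -/
def sq (x : Fin 8) (y : Fin 4) : Fin 8 × Fin 4 :=
  (⟨(x.val * x.val + 2 * y.val * y.val) % 8, Nat.mod_lt _ (by decide)⟩,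
   ⟨(2 * x.val * y.val) % 4, Nat.mod_lt _ (by decide)⟩)

/-- `−β` reduced mod `4√2` for `β = a + b√2` with `a, b ≥ 0`: the pair `(−a mod 8, −b mod 4)` -/
def negClass (a b : Nat) : Fin 8 × Fin 4 :=
  (⟨(8 - a % 8) % 8, Nat.mod_lt _ (by decide)⟩, ⟨(4 - b % 4) % 4, Nat.mod_lt _ (by decide)⟩)

/-- the five `β = a + b√2` of P7-Zeta8Instance §1 as pairs `(a, b)`: `3+√2, 5+√2, 4+√2, 3, 2+√2` -/
def betas : List (Nat × Nat) := [(3, 1), (5, 1), (4, 1), (3, 0), (2, 1)]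

/-- no `z = x + y√2` has `z² ≡ −β (mod 4√2)` for any of the five `β` -/
theorem no_square : ∀ β ∈ betas, ∀ x : Fin 8, ∀ y : Fin 4, sq x y ≠ negClass β.1 β.2 := by decide

/-- the unit squares mod `4√2` are exactly the classes `1` and `3 + 2√2` -/
theorem unit_squares : ∀ x : Fin 8, ∀ y : Fin 4, x.val % 2 = 1 →
    sq x y = ((1 : Fin 8), (0 : Fin 4)) ∨ sq x y = ((3 : Fin 8), (2 : Fin 4)) := by decide

/-- both classes occur (`1 = 1²`, `3 + 2√2 = (1 + √2)²`) -/
theorem unit_squares_attained : sq 1 0 = ((1 : Fin 8), (0 : Fin 4)) ∧ sq 1 1 = ((3 : Fin 8), (2 : Fin 4)) := by decide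

/-- control: `−7 ≡ 1 (mod 8)` is a square class (β = 7 is completely split, zeta8_split.gp) -/
theorem control_seven : ∃ x : Fin 8, ∃ y : Fin 4, sq x y = negClass 7 0 := by decide

/-- control: `−(13 + 2√2) ≡ 3 + 2√2 (mod 4√2)` is a square class (β = 13 + 2√2 is completely split, zeta8_split.gp) -/
theorem control_thirteen : ∃ x : Fin 8, ∃ y : Fin 4, sq x y = negClass 13 2 := by decide

/-- control: `−(9 + 2√2)` is not a square class (β = 9 + 2√2 is not completely split, zeta8_split.gp) -/
theorem control_nine : ∀ x : Fin 8, ∀ y : Fin 4, sq x y ≠ negClass 9 2 := by decide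

end HodgeRepro0.Zeta8Criterion
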